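import Summits.QuantumFields.GaugeBoot.TiltedBoxTwoDimOddMidBlocks
import Summits.QuantumFields.GaugeBoot.TiltedLatticeMidReflection
import HarnessLib

/-!
# The reduced half of the LINK mirror of the odd square tilted box in general dimension: weights and rest (gauge-boot, L3 supplement: reduced-half in-plane mirrors, odd twin 1)

HONEST FRAMING (cell `pub-gaugeboot`, page 1 of every file): the venture produces certified bounds
on lattice expectations at stated coupling, gauge group, dimension and torus size; NOT a mass gap,
NOT a continuum limit, NOT a string tension; NOT Yang–Mills-summit-bearing (barriers
`FixedCouplingUltralocality`, `PerturbativeInvisibility`). This module is bookkeeping for a small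
structural NEGATIVE result (the REDUCED-half in-plane mirrors of the square tilted boxes are not of
positive type in `d ≥ 3` at small coupling); it discharges nothing by itself.

## Content (odd box `ℤ^d/Γ(2P+1, 2P+1, L)`, `P ≥ 2`, LINK mirror `Θ : x_i ↦ 1 - x_i`, any `d`)

The twin of `TiltedBoxRedSiteGeometry.lean` for the link mirror `configMidReflect e i σ` of the ODD box
(`TiltedBoxOddMidAxisRPNegative.lean`: the closed half `{1 ≤ x_i ≤ P + 1}` fails at every `β`; gen 50's
`TwoDim.tiltedBox_midAxisRP_odd_twoDim`: the REDUCED half `{1 ≤ x_i ≤ P}` (`TwoDim.IsRedLink`, twisted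
layer `x_i ≡ P + 1` free) holds in `d = 2`). For general `d`:

* weights `wTL` (transverse plaquette of the layer `a`: `1` iff `1 ≤ a ≤ P`) and `wLL` (plaquette with an
  `i`-side based in the layer `a`: `1` iff `1 ≤ a ≤ P - 1`), `redWL p`; the REST `IsRestL` (the slabs
  `0|1`, `P|P+1`, `P+1|P+2` and the transverse plaquettes of the free layer `P + 1`) and the cancellation
  identity **`redWL_add_redWL_plaqMidReflect`** (`c_p + c_{Θp} = 0` on the rest, `1` elsewhere);
* `isRedLink_of_redWL_ne_zero` — a plaquette of non-zero weight reads only reduced-half links;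
* `plaqObs_configMidReflect_eq` — `Re tr ρ((ΘU)_p) = Re tr ρ(U_{plaqMidReflect p})`;
* the half-weighted action `redExpoL` and ★ **`redExpoL_configMidReflect_add`**:
  `E(ΘU) + E(U) - S(U) = -∑_{rest} (N - Re tr ρ(U_q))`.

Elementary; mechanism folklore.
-/

noncomputable section

open QuotientAddGroup Finset Function MeasureTheory
open scoped ComplexConjugate

namespace Summit.QuantumFields.GaugeBoot

namespace TiltedRP

namespace RedLink

variable {d : ℕ} {i j : Fin d} {L P N : ℕ} [NeZero L] [NeZero P]
variable {G : Type*} [Group G]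

/-! ## `val` arithmetic modulo `2P + 1` -/

omit [NeZero L] [NeZero P] in
/-- `(-a).val` in `ZMod (2P+1)`. [folklore] -/
theorem val_neg_odd (a : ZMod (2 * P + 1)) : (-a).val = if a.val = 0 then 0 else 2 * P + 1 - a.val := by
  rw [ZMod.neg_val]
  by_cases h : a = 0
  · rw [if_pos h, if_pos (by rw [h, ZMod.val_zero])]
  · rw [if_neg h, if_neg (fun h' => h ((ZMod.val_eq_zero a).1 h'))]

omit [NeZero L] in
/-- `(-a + 1).val` in `ZMod (2P+1)`: `0 ↦ 1`, `1 ↦ 0`, otherwise `2P + 2 - a.val`. [folklore] -/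
theorem val_neg_add_one_odd (a : ZMod (2 * P + 1)) :
    (-a + 1).val = if a.val = 0 then 1 else if a.val = 1 then 0 else 2 * P + 2 - a.val := by
  have ha := ZMod.val_lt a
  rw [TwoDim.val_add_one_eq, val_neg_odd]
  by_cases h0 : a.val = 0
  · rw [if_pos h0, if_neg (by have := NeZero.ne P; omega), if_pos h0]
  · rw [if_neg h0, if_neg h0]
    by_cases h1 : a.val = 1
    · rw [if_pos (by omega), if_pos h1]
    · rw [if_neg (by omega), if_neg h1]; omega

/-! ## The reduced-half weights -/

variable (P) in
/-- Weight of a TRANSVERSE plaquette (no `i`-side) inside the layer `x_i ≡ a` of the odd box, for the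
reduced half `{1 ≤ x_i ≤ P}` of the link mirror: `1` iff `1 ≤ a ≤ P`. [folklore] -/
def wTL (a : ZMod (2 * P + 1)) : ℝ := if 1 ≤ a.val ∧ a.val ≤ P then 1 else 0

variable (P) in
/-- Weight of a LONGITUDINAL plaquette (with an `i`-side) based in the layer `a`: `1` iff both layers
`a`, `a + 1` are in the reduced half, `1 ≤ a ≤ P - 1`. [folklore] -/
def wLL (a : ZMod (2 * P + 1)) : ℝ := if 1 ≤ a.val ∧ a.val + 1 ≤ P then 1 else 0

omit [NeZero L] in
/-- `wTL(a) + wTL(1 - a) = 1` off the free layer `a = P + 1`, `= 0` on it. [folklore] -/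
theorem wTL_add_wTL_refl (hP : 2 ≤ P) (a : ZMod (2 * P + 1)) :
    wTL P a + wTL P (-a + 1) = if a.val = P + 1 then 0 else 1 := by
  have ha := ZMod.val_lt a
  unfold wTL
  rw [val_neg_add_one_odd]
  split_ifs <;> norm_num <;> omega

omit [NeZero L] [NeZero P] in
/-- `wLL(a) + wLL(-a) = 1` off the three slabs `0|1`, `P|P+1`, `P+1|P+2`, `= 0` on them. [folklore] -/
theorem wLL_add_wLL_refl (hP : 2 ≤ P) (a : ZMod (2 * P + 1)) :
    wLL P a + wLL P (-a) = if a.val = 0 ∨ a.val = P ∨ a.val = P + 1 then 0 else 1 := by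
  have ha := ZMod.val_lt a
  unfold wLL
  rw [val_neg_odd]
  split_ifs <;> norm_num <;> omega

/-- **The reduced-half weight of a plaquette** of the odd box (link mirror): `wLL` of its base layer if
it has an `i`-side, `wTL` otherwise. [folklore] -/
def redWL (p : Plaq (TiltedSite d i j (2 * P + 1) (2 * P + 1) L) d) : ℝ :=
  if p.2.1.1 = i ∨ p.2.1.2 = i then wLL P (axisCoord d L (2 * P + 1) p.1)
  else wTL P (axisCoord d L (2 * P + 1) p.1)

/-- **A REST plaquette** of the link mirror of the odd box: with an `i`-side and based in the layer `0`,
`P` or `P + 1` (the exact slab `0|1` and the two slabs around the free layer), or transverse inside the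
free layer `x_i ≡ P + 1`. [folklore] -/
def IsRestL (p : Plaq (TiltedSite d i j (2 * P + 1) (2 * P + 1) L) d) : Prop :=
  ((p.2.1.1 = i ∨ p.2.1.2 = i) ∧
      ((axisCoord d L (2 * P + 1) p.1).val = 0 ∨ (axisCoord d L (2 * P + 1) p.1).val = P ∨
        (axisCoord d L (2 * P + 1) p.1).val = P + 1)) ∨
    (¬ (p.2.1.1 = i ∨ p.2.1.2 = i) ∧ (axisCoord d L (2 * P + 1) p.1).val = P + 1)

/-- `IsRestL` is decidable. [folklore] -/
instance instDecidableIsRestL (p : Plaq (TiltedSite d i j (2 * P + 1) (2 * P + 1) L) d) :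
    Decidable (IsRestL (P := P) p) := by
  unfold IsRestL; infer_instance

variable (d i j L P) in
/-- The finite set of rest plaquettes. [folklore] -/
def restSetL : Finset (Plaq (TiltedSite d i j (2 * P + 1) (2 * P + 1) L) d) :=
  univ.filter fun p => IsRestL (P := P) p

omit [NeZero P] in
/-- Membership in the rest set. [folklore] -/
theorem mem_restSetL {p : Plaq (TiltedSite d i j (2 * P + 1) (2 * P + 1) L) d} :
    p ∈ restSetL d i j L P ↔ IsRestL (P := P) p := by
  simp [restSetL]

omit [NeZero L] in
/-- **The cancellation identity**: `c_p + c_{Θ p} = 0` for rest plaquettes, `= 1` for all others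
(`Θ p = plaqMidReflect`, the link mirror along `i`). [folklore] -/
theorem redWL_add_redWL_plaqMidReflect (hP : 2 ≤ P) (hij : i ≠ j)
    (p : Plaq (TiltedSite d i j (2 * P + 1) (2 * P + 1) L) d) :
    redWL p + redWL (plaqMidReflect (tiltedUnit d i j (2 * P + 1) (2 * P + 1) L) i
      (tiltedAxisFlip d L (2 * P + 1) hij) p) = if IsRestL (P := P) p then 0 else 1 := by
  unfold redWL IsRestL
  rw [plaqMidReflect_snd]
  by_cases hp : p.2.1.1 = i ∨ p.2.1.2 = i
  · rw [if_pos hp, if_pos hp, plaqMidReflect_fst_of_hasDir hp, axisCoord_tiltedAxisFlip, wLL_add_wLL_refl hP]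
    by_cases ha : (axisCoord d L (2 * P + 1) p.1).val = 0 ∨ (axisCoord d L (2 * P + 1) p.1).val = P ∨
        (axisCoord d L (2 * P + 1) p.1).val = P + 1
    · rw [if_pos ha, if_pos (Or.inl ⟨hp, ha⟩)]
    · rw [if_neg ha, if_neg (by rintro (⟨-, h⟩ | ⟨h, -⟩); exacts [ha h, h hp])]
  · rw [if_neg hp, if_neg hp, plaqMidReflect_fst_of_not_hasDir hp, midReflect, map_add, axisCoord_tiltedAxisFlip,
      axisCoord_tiltedUnit_self, wTL_add_wTL_refl hP]
    by_cases ha : (axisCoord d L (2 * P + 1) p.1).val = P + 1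
    · rw [if_pos ha, if_pos (Or.inr ⟨hp, ha⟩)]
    · rw [if_neg ha, if_neg (by rintro (⟨h, -⟩ | ⟨-, h⟩); exacts [hp h, ha h])]

/-! ## Plaquettes of non-zero weight read only the reduced half -/

omit [NeZero L] in
/-- `x_i(x + e_k) = x_i(x) + [k = i]` as natural numbers, away from the top of `ZMod (2P+1)`. [folklore] -/
theorem val_axisCoord_add_tiltedUnit_odd (x : TiltedSite d i j (2 * P + 1) (2 * P + 1) L) (k : Fin d)
    (hx : (axisCoord d L (2 * P + 1) x).val + 1 ≤ 2 * P) :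
    (axisCoord d L (2 * P + 1) (x + tiltedUnit d i j (2 * P + 1) (2 * P + 1) L k)).val =
      (axisCoord d L (2 * P + 1) x).val + if k = i then 1 else 0 := by
  rw [axisCoord_add_tiltedUnit]
  by_cases hk : k = i
  · rw [if_pos hk, if_pos hk, TwoDim.val_add_one_eq, if_neg (by omega)]
  · rw [if_neg hk, if_neg hk, add_zero, add_zero]

omit [NeZero L] in
/-- **A plaquette with non-zero reduced-half weight has all four links in the reduced half**
`{1 ≤ x_i ≤ P}` (both endpoints). [folklore] -/
theorem isRedLink_of_redWL_ne_zero (hP : 2 ≤ P) {p : Plaq (TiltedSite d i j (2 * P + 1) (2 * P + 1) L) d}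
    (hp : redWL p ≠ 0) :
    TwoDim.IsRedLink (P := P) (p.1, p.2.1.1) ∧
    TwoDim.IsRedLink (P := P) (p.1 + tiltedUnit d i j (2 * P + 1) (2 * P + 1) L p.2.1.1, p.2.1.2) ∧
    TwoDim.IsRedLink (P := P) (p.1 + tiltedUnit d i j (2 * P + 1) (2 * P + 1) L p.2.1.2, p.2.1.1) ∧
    TwoDim.IsRedLink (P := P) (p.1, p.2.1.2) := by
  have hkl : p.2.1.1 ≠ p.2.1.2 := ne_of_lt p.2.2
  have hbudget : 1 ≤ (axisCoord d L (2 * P + 1) p.1).val ∧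
      (axisCoord d L (2 * P + 1) p.1).val + (if p.2.1.1 = i then 1 else 0) + (if p.2.1.2 = i then 1 else 0) ≤ P := by
    unfold redWL at hp
    by_cases hd : p.2.1.1 = i ∨ p.2.1.2 = i
    · rw [if_pos hd] at hp
      unfold wLL at hp
      have h2 : 1 ≤ (axisCoord d L (2 * P + 1) p.1).val ∧ (axisCoord d L (2 * P + 1) p.1).val + 1 ≤ P := by
        by_contra h; exact hp (if_neg h)
      rcases hd with h | h
      · rw [if_pos h, if_neg (fun h' => hkl (h.trans h'.symm))]; omega
      · rw [if_neg (fun h' => hkl (h'.trans h.symm)), if_pos h]; omega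
    · rw [if_neg hd] at hp
      unfold wTL at hp
      rw [not_or] at hd
      rw [if_neg hd.1, if_neg hd.2]
      have h1 : 1 ≤ (axisCoord d L (2 * P + 1) p.1).val ∧ (axisCoord d L (2 * P + 1) p.1).val ≤ P := by
        by_contra h; exact hp (if_neg h)
      omega
  have hv1 : (axisCoord d L (2 * P + 1) (p.1 + tiltedUnit d i j (2 * P + 1) (2 * P + 1) L p.2.1.1)).val =
      (axisCoord d L (2 * P + 1) p.1).val + if p.2.1.1 = i then 1 else 0 :=
    val_axisCoord_add_tiltedUnit_odd p.1 p.2.1.1 (by split_ifs at hbudget <;> omega)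
  have hv2 : (axisCoord d L (2 * P + 1) (p.1 + tiltedUnit d i j (2 * P + 1) (2 * P + 1) L p.2.1.2)).val =
      (axisCoord d L (2 * P + 1) p.1).val + if p.2.1.2 = i then 1 else 0 :=
    val_axisCoord_add_tiltedUnit_odd p.1 p.2.1.2 (by split_ifs at hbudget <;> omega)
  have hv12 : (axisCoord d L (2 * P + 1) (p.1 + tiltedUnit d i j (2 * P + 1) (2 * P + 1) L p.2.1.1 +
      tiltedUnit d i j (2 * P + 1) (2 * P + 1) L p.2.1.2)).val =
      (axisCoord d L (2 * P + 1) p.1).val + (if p.2.1.1 = i then 1 else 0) + if p.2.1.2 = i then 1 else 0 := by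
    rw [val_axisCoord_add_tiltedUnit_odd _ p.2.1.2 (by rw [hv1]; split_ifs at hbudget ⊢ <;> omega), hv1]
  have hv21 : (axisCoord d L (2 * P + 1) (p.1 + tiltedUnit d i j (2 * P + 1) (2 * P + 1) L p.2.1.2 +
      tiltedUnit d i j (2 * P + 1) (2 * P + 1) L p.2.1.1)).val =
      (axisCoord d L (2 * P + 1) p.1).val + (if p.2.1.1 = i then 1 else 0) + if p.2.1.2 = i then 1 else 0 := by
    rw [add_right_comm]; exact hv12
  unfold TwoDim.IsRedLink
  dsimp only
  refine ⟨⟨⟨?_, ?_⟩, ?_, ?_⟩, ⟨⟨?_, ?_⟩, ?_, ?_⟩, ⟨⟨?_, ?_⟩, ?_, ?_⟩, ⟨⟨?_, ?_⟩, ?_, ?_⟩⟩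
  all_goals first
    | (split_ifs at hbudget <;> omega)
    | (rw [hv1]; split_ifs at hbudget ⊢ <;> omega)
    | (rw [hv2]; split_ifs at hbudget ⊢ <;> omega)
    | (rw [hv12]; split_ifs at hbudget ⊢ <;> omega)
    | (rw [hv21]; split_ifs at hbudget ⊢ <;> omega)

variable (ρ : G →* Matrix (Fin N) (Fin N) ℂ)

omit [NeZero L] in
/-- Plaquette observables agree on configurations agreeing on the reduced-half links, for plaquettes
of non-zero weight. [folklore] -/
theorem plaqObs_eq_of_redWL_ne_zero (hP : 2 ≤ P)
    {U V : Config (TiltedSite d i j (2 * P + 1) (2 * P + 1) L) d G}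
    (hUV : ∀ l, TwoDim.IsRedLink (P := P) l → U l = V l)
    {p : Plaq (TiltedSite d i j (2 * P + 1) (2 * P + 1) L) d} (hp : redWL p ≠ 0) :
    plaqObs ρ (tiltedUnit d i j (2 * P + 1) (2 * P + 1) L) p U =
      plaqObs ρ (tiltedUnit d i j (2 * P + 1) (2 * P + 1) L) p V := by
  obtain ⟨h1, h2, h3, h4⟩ := isRedLink_of_redWL_ne_zero hP hp
  unfold plaqObs
  rw [holonomy_congr _ p.1 p.2.1.1 p.2.1.2 (hUV _ h1) (hUV _ h2) (hUV _ h3) (hUV _ h4)]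

/-! ## The mirror on plaquette observables -/

omit [NeZero L] [NeZero P] in
/-- **`Re tr ρ((Θ_mid U)_p) = Re tr ρ(U_{plaqMidReflect p})`** for the link mirror of the odd box.
[folklore] -/
theorem plaqObs_configMidReflect_eq [TopologicalSpace G] [IsTopologicalGroup G] [CompactSpace G]
    (hij : i ≠ j) (hρ : Continuous ρ) (p : Plaq (TiltedSite d i j (2 * P + 1) (2 * P + 1) L) d)
    (U : Config (TiltedSite d i j (2 * P + 1) (2 * P + 1) L) d G) :
    plaqObs ρ (tiltedUnit d i j (2 * P + 1) (2 * P + 1) L) p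
        (configMidReflect (tiltedUnit d i j (2 * P + 1) (2 * P + 1) L) i (tiltedAxisFlip d L (2 * P + 1) hij) U) =
      plaqObs ρ (tiltedUnit d i j (2 * P + 1) (2 * P + 1) L)
        (plaqMidReflect (tiltedUnit d i j (2 * P + 1) (2 * P + 1) L) i (tiltedAxisFlip d L (2 * P + 1) hij) p) U := by
  rw [configMidReflect_eq_configReflect_translate, (isAxisFlip_tiltedAxisFlip d L (2 * P + 1) hij).plaqObs_configReflect ρ hρ,
    plaqObs_translate, plaqMidReflect_eq_plaqReflect_add]

/-! ## The half-weighted action and the cancellation of the Boltzmann weight -/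

/-- The half-weighted action `E(U) = ∑_p c_p (N - Re tr ρ(U_p))` of the reduced half (general `d`).
[folklore] -/
def redExpoL (U : Config (TiltedSite d i j (2 * P + 1) (2 * P + 1) L) d G) : ℝ :=
  ∑ p : Plaq (TiltedSite d i j (2 * P + 1) (2 * P + 1) L) d,
    redWL p * ((N : ℝ) - plaqObs ρ (tiltedUnit d i j (2 * P + 1) (2 * P + 1) L) p U)

omit [NeZero P] in
/-- `E` is continuous. [folklore] -/
theorem continuous_redExpoL [TopologicalSpace G] [IsTopologicalGroup G] (hρ : Continuous ρ) :
    Continuous fun U : Config (TiltedSite d i j (2 * P + 1) (2 * P + 1) L) d G => redExpoL ρ U :=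
  continuous_finsetSum _ fun p _ => continuous_const.mul (continuous_const.sub (continuous_plaqObs ρ hρ _ p))

/-- `E` reads only the reduced half. [folklore] -/
theorem redExpoL_eq_of_redLinks (hP : 2 ≤ P) {U V : Config (TiltedSite d i j (2 * P + 1) (2 * P + 1) L) d G}
    (hUV : ∀ l, TwoDim.IsRedLink (P := P) l → U l = V l) : redExpoL ρ U = redExpoL ρ V := by
  unfold redExpoL
  refine Finset.sum_congr rfl fun p _ => ?_
  by_cases hp : redWL p = 0
  · rw [hp, zero_mul, zero_mul]
  · rw [plaqObs_eq_of_redWL_ne_zero ρ hP hUV hp]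

/-- ★ **`E(ΘU) + E(U) - S(U) = -∑_{rest} (N - Re tr ρ(U_q))`.** [folklore] -/
theorem redExpoL_configMidReflect_add [TopologicalSpace G] [IsTopologicalGroup G] [CompactSpace G]
    (hP : 2 ≤ P) (hij : i ≠ j) (hρ : Continuous ρ) (U : Config (TiltedSite d i j (2 * P + 1) (2 * P + 1) L) d G) :
    redExpoL ρ (configMidReflect (tiltedUnit d i j (2 * P + 1) (2 * P + 1) L) i (tiltedAxisFlip d L (2 * P + 1) hij) U) +
      redExpoL ρ U - wilsonAction ρ (tiltedUnit d i j (2 * P + 1) (2 * P + 1) L) U =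
      -∑ p ∈ restSetL d i j L P, ((N : ℝ) - plaqObs ρ (tiltedUnit d i j (2 * P + 1) (2 * P + 1) L) p U) := by
  have hF : IsAxisFlip (tiltedUnit d i j (2 * P + 1) (2 * P + 1) L) i (tiltedAxisFlip d L (2 * P + 1) hij) :=
    isAxisFlip_tiltedAxisFlip d L (2 * P + 1) hij
  have h1 : redExpoL ρ (configMidReflect (tiltedUnit d i j (2 * P + 1) (2 * P + 1) L) i (tiltedAxisFlip d L (2 * P + 1) hij) U) =
      ∑ p : Plaq (TiltedSite d i j (2 * P + 1) (2 * P + 1) L) d,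
        redWL (plaqMidReflect (tiltedUnit d i j (2 * P + 1) (2 * P + 1) L) i (tiltedAxisFlip d L (2 * P + 1) hij) p) *
          ((N : ℝ) - plaqObs ρ (tiltedUnit d i j (2 * P + 1) (2 * P + 1) L) p U) := by
    unfold redExpoL
    have h := hF.sum_plaqMidReflect_configMidReflect ρ hρ
      (fun p => redWL (plaqMidReflect (tiltedUnit d i j (2 * P + 1) (2 * P + 1) L) i (tiltedAxisFlip d L (2 * P + 1) hij) p))
      (fun r => (N : ℝ) - r) U
    simp only [hF.plaqMidReflect_plaqMidReflect] at h
    exact h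
  rw [h1, redExpoL, wilsonAction, ← Finset.sum_add_distrib, ← Finset.sum_sub_distrib, ← Finset.sum_neg_distrib,
    restSetL, Finset.sum_filter]
  refine Finset.sum_congr rfl fun p _ => ?_
  have h2 := redWL_add_redWL_plaqMidReflect hP hij p
  rw [add_comm] at h2
  by_cases hs : IsRestL (P := P) p
  · rw [if_pos hs] at h2; rw [if_pos hs]
    linear_combination ((N : ℝ) - plaqObs ρ (tiltedUnit d i j (2 * P + 1) (2 * P + 1) L) p U) * h2
  · rw [if_neg hs] at h2; rw [if_neg hs]
    linear_combination ((N : ℝ) - plaqObs ρ (tiltedUnit d i j (2 * P + 1) (2 * P + 1) L) p U) * h2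

end RedLink

end TiltedRP

end Summit.QuantumFields.GaugeBoot

end
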